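import Summits.CriticalPhenomena.PercolationContinuityZ3.Theorems.PercNearOneGluingNoHeavyQuantZeroOneK4
import Summits.CriticalPhenomena.PercolationContinuityZ3.Theorems.PercNearOneGluingNoHeavyQuantThreePortTransfer
import Literature.Probability.Percolation.GladkovThreeClusterDichotomyProofs
import Literature.Probability.Percolation.HierarchicalPercolation
import HarnessLib

/-!
# `Z(3,2)` at a three-port observer with near-`½` hairs — for EVERY graph off the observer (Gladkov–Zimin off `o`)

builds on p205010 (kernel theorem, internal audit signed; external expert review pending)

Support file (`--supports stmt-CriticalPhenomena-4575`), seat `prim-quant-p1` (gen 4); memo `run/shared/lean/prim/quant/P1-SURPLUS.md` §14.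
No definitions, no named facts, no sorries; standard axioms.  SETTING (`ThreePort`, prim-ineq-gen-8 gen 9): THREE-PORT observer `o` (pairs at
`o` other than `o–a, o–b, o–c` have weight `0`), hairs `α, β, γ`, ARBITRARY graph off `o`, off-`o` cells `U0, Uab, Uac, Ubc, U3`.
* `ThreePort.gz_offObserver` — **Gladkov–Zimin for the off-`o` cells**: `(U0 + Ubc)(Uab + Uac + U3) ≤ Uab + Uac + Ubc` (tree theorem
  `gladkovZimin2024_threePoint_prodBernoulli` transported along `ω ↦ ω ∩ {e | o ∉ e}`, whose law is `prodBernoulli` of the weights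
  switched off at `o`, `prodBernoulli_map_inter`).
* `ThreePort.nearHalf_residual_false` (pure real algebra) — hairs in `[9/20, ½]`, the three exchanges failing (`U0·T_v + U_opp(v)·V_v < 0`,
  `ThreePort.margin_eq`), the GZ row and `Σ > 2` are contradictory.  CHAIN: on the hair box `V_v ≥ 79/400`, `T_a⁻+T_b⁻+T_c⁻ ≤ 297/4000`,
  `T_a⁻ ≤ 1/20` (multilinear polynomials, monotone in each hair) ⟹ pairs `P < (297/790)·U0`, `Ubc < (20/79)·U0`; GZ with `I = U0 + Ubc`:
  `I(1−I) ≤ P < (297/790) I` ⟹ `I > 493/790`; `Σ ≤ 3/2 + P/2 + c̄₃ U3` (`c_pair ≤ ½`, `c₃ ≤ c̄₃ = 9207/8000`), `U3 = 1 − U0 − P`, `P ≥ I(1−I)`,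
  `U0 ≥ (79/99) I` leave a convex quadratic in `I`, `< 1.93` on `[493/790, 1]` (`nearHalf_quadratic_bound`).
* `ThreePort.le_one_reached_le_of_nearHalf_hairs` — **at a three-port observer whose hairs lie in `[9/20, ½]`, `Z(3,2)` holds for every
  finite weighted graph off `o`**: `Σ_v μ(o↔v) > 2`, `t ≥ μ(o↮v)` ⟹ `μ{N ≤ 1} ≤ t`; `…_of_hairs_ge`: all hairs `≥ 9/20` (any size) suffice.
WHY HERE.  The `½`-star sliver (three hairs just below `½` + a weak hub, `n = 5`) is where POCKET-½ / MAJORITY / Zmax die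
(`OneCutFivePocketHalfRefutation`) and where layer-1 FAR-shape violators reach their largest mean (`Σ ≈ 1.502`); this file shows `Z(3,2)` itself
is a THEOREM there, at every three-port observer and for every graph beyond it, from one printed input (Gladkov–Zimin 2024, Thm 4.6).  Open at a
three-port observer: some hair `< 9/20` and none `≥ ½` — containing the near-dominant-hair corner `(.44,.24,.24)` of prim-ineq-gen-8 gen 9
(linear-rate APL row); `9/20` is what constant bounds give (memo §14.7 has the abstract optimum of 'caps + three GZ rows').
[cite: GladkovZimin2024, Thm. 4.6]; [cite: KozmaNitzan2024, Lemma 2 (p. 6)] (context: level 1 of the family).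
-/

noncomputable section

namespace Summit.CriticalPhenomena.PercolationContinuityZ3.Theorems

open MeasureTheory Set Literature.Probability.LatticeModels Literature.Probability.Percolation
open scoped Classical BigOperators

variable {n : ℕ}

namespace ThreePort

/-! ### Gladkov–Zimin off the observer -/

/-- **Gladkov–Zimin's three-point inequality for the cells off `o`**: with `R x y` = "`x, y` joined in `openGraph (ω ∩ {e | o ∉ e})`",
`(U0 + Ubc)·(Uab + Uac + U3) ≤ Uab + Uac + Ubc`, i.e. `μ(a ≁ b, a ≁ c)·μ(a ~ b ∨ a ~ c) ≤ μ(exactly one pair joined)`.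
Transport of the tree theorem `gladkovZimin2024_threePoint_prodBernoulli` along `ω ↦ ω ∩ {e | o ∉ e}` (`prodBernoulli_map_inter`).
[cite: GladkovZimin2024, Thm. 4.6] -/
theorem gz_offObserver (w : Sym2 (Fin n) → unitInterval) (o a b c : Fin n) :
    ((prodBernoulli w).real {ω | ¬ (openGraph (ω ∩ {e | o ∉ e})).Reachable a b ∧
        ¬ (openGraph (ω ∩ {e | o ∉ e})).Reachable a c ∧ ¬ (openGraph (ω ∩ {e | o ∉ e})).Reachable b c} +
      (prodBernoulli w).real {ω | (openGraph (ω ∩ {e | o ∉ e})).Reachable b c ∧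
        ¬ (openGraph (ω ∩ {e | o ∉ e})).Reachable a b}) *
      ((prodBernoulli w).real {ω | (openGraph (ω ∩ {e | o ∉ e})).Reachable a b ∧
          ¬ (openGraph (ω ∩ {e | o ∉ e})).Reachable a c} +
        (prodBernoulli w).real {ω | (openGraph (ω ∩ {e | o ∉ e})).Reachable a c ∧
          ¬ (openGraph (ω ∩ {e | o ∉ e})).Reachable a b} +
        (prodBernoulli w).real {ω | (openGraph (ω ∩ {e | o ∉ e})).Reachable a b ∧
          (openGraph (ω ∩ {e | o ∉ e})).Reachable a c}) ≤
      (prodBernoulli w).real {ω | (openGraph (ω ∩ {e | o ∉ e})).Reachable a b ∧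
          ¬ (openGraph (ω ∩ {e | o ∉ e})).Reachable a c} +
        (prodBernoulli w).real {ω | (openGraph (ω ∩ {e | o ∉ e})).Reachable a c ∧
          ¬ (openGraph (ω ∩ {e | o ∉ e})).Reachable a b} +
        (prodBernoulli w).real {ω | (openGraph (ω ∩ {e | o ∉ e})).Reachable b c ∧
          ¬ (openGraph (ω ∩ {e | o ∉ e})).Reachable a b} := by
  set D : Set (Sym2 (Fin n)) := {e | o ∉ e} with hD
  set w' : Sym2 (Fin n) → unitInterval := fun e => if e ∈ D then w e else 0 with hw'
  have hmap : (prodBernoulli w).map (fun ξ : BondConfig (Fin n) => ξ ∩ D) = prodBernoulli w' :=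
    prodBernoulli_map_inter w D
  have htr : ∀ S : Set (BondConfig (Fin n)),
      (prodBernoulli w).real ((fun ξ : BondConfig (Fin n) => ξ ∩ D) ⁻¹' S) = (prodBernoulli w').real S := by
    intro S
    rw [← hmap, map_measureReal_apply (Measurable.of_discrete) MeasurableSet.of_discrete]
  set μ' := prodBernoulli w' with hμ'
  have eU0 : (prodBernoulli w).real {ω | ¬ (openGraph (ω ∩ D)).Reachable a b ∧
      ¬ (openGraph (ω ∩ D)).Reachable a c ∧ ¬ (openGraph (ω ∩ D)).Reachable b c} =
      μ'.real {ξ | ¬ (openGraph ξ).Reachable a b ∧ ¬ (openGraph ξ).Reachable a c ∧ ¬ (openGraph ξ).Reachable b c} :=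
    htr {ξ | ¬ (openGraph ξ).Reachable a b ∧ ¬ (openGraph ξ).Reachable a c ∧ ¬ (openGraph ξ).Reachable b c}
  have eab : (prodBernoulli w).real {ω | (openGraph (ω ∩ D)).Reachable a b ∧ ¬ (openGraph (ω ∩ D)).Reachable a c} =
      μ'.real {ξ | (openGraph ξ).Reachable a b ∧ ¬ (openGraph ξ).Reachable a c} :=
    htr {ξ | (openGraph ξ).Reachable a b ∧ ¬ (openGraph ξ).Reachable a c}
  have eac : (prodBernoulli w).real {ω | (openGraph (ω ∩ D)).Reachable a c ∧ ¬ (openGraph (ω ∩ D)).Reachable a b} =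
      μ'.real {ξ | (openGraph ξ).Reachable a c ∧ ¬ (openGraph ξ).Reachable a b} :=
    htr {ξ | (openGraph ξ).Reachable a c ∧ ¬ (openGraph ξ).Reachable a b}
  have ebc : (prodBernoulli w).real {ω | (openGraph (ω ∩ D)).Reachable b c ∧ ¬ (openGraph (ω ∩ D)).Reachable a b} =
      μ'.real {ξ | (openGraph ξ).Reachable b c ∧ ¬ (openGraph ξ).Reachable a b} :=
    htr {ξ | (openGraph ξ).Reachable b c ∧ ¬ (openGraph ξ).Reachable a b}
  have e3 : (prodBernoulli w).real {ω | (openGraph (ω ∩ D)).Reachable a b ∧ (openGraph (ω ∩ D)).Reachable a c} =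
      μ'.real {ξ | (openGraph ξ).Reachable a b ∧ (openGraph ξ).Reachable a c} :=
    htr {ξ | (openGraph ξ).Reachable a b ∧ (openGraph ξ).Reachable a c}
  rw [eU0, eab, eac, ebc, e3]
  have hGZ := gladkovZimin2024_threePoint_prodBernoulli w' a b c
  have hI : μ'.real ((openConn a b)ᶜ ∩ (openConn a c)ᶜ : Set (BondConfig (Fin n))) =
      μ'.real {ξ | (openGraph ξ).Reachable b c ∧ ¬ (openGraph ξ).Reachable a b} +
        μ'.real {ξ | ¬ (openGraph ξ).Reachable a b ∧ ¬ (openGraph ξ).Reachable a c ∧ ¬ (openGraph ξ).Reachable b c} := by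
    rw [← real_notR_notR μ' (fun ξ => openGraph ξ) a b c]; rfl
  have hJ : μ'.real (openConn a b ∪ openConn a c : Set (BondConfig (Fin n))) =
      μ'.real {ξ | (openGraph ξ).Reachable a b ∧ ¬ (openGraph ξ).Reachable a c} +
        μ'.real {ξ | (openGraph ξ).Reachable a c ∧ ¬ (openGraph ξ).Reachable a b} +
        μ'.real {ξ | (openGraph ξ).Reachable a b ∧ (openGraph ξ).Reachable a c} := by
    rw [← real_Rba_or_Rca μ' (fun ξ => openGraph ξ) a b c]
    congr 1; ext ξ
    simp only [Set.mem_union, Set.mem_setOf_eq]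
    exact ⟨fun h => h.elim (fun h1 => Or.inl (SimpleGraph.Reachable.symm h1)) fun h1 => Or.inr (SimpleGraph.Reachable.symm h1),
      fun h => h.elim (fun h1 => Or.inl (SimpleGraph.Reachable.symm h1)) fun h1 => Or.inr (SimpleGraph.Reachable.symm h1)⟩
  have hu1 : μ'.real (openConn a b ∩ (openConn a c)ᶜ : Set (BondConfig (Fin n))) =
      μ'.real {ξ | (openGraph ξ).Reachable a b ∧ ¬ (openGraph ξ).Reachable a c} := rfl
  have hu2 : μ'.real (openConn a c ∩ (openConn a b)ᶜ : Set (BondConfig (Fin n))) =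
      μ'.real {ξ | (openGraph ξ).Reachable a c ∧ ¬ (openGraph ξ).Reachable a b} := rfl
  have hu3 : μ'.real ((openConn a b)ᶜ ∩ (openConn a c)ᶜ ∩ openConn b c : Set (BondConfig (Fin n))) =
      μ'.real {ξ | (openGraph ξ).Reachable b c ∧ ¬ (openGraph ξ).Reachable a b} := by
    congr 1; ext ξ
    simp only [Set.mem_inter_iff, Set.mem_compl_iff, Set.mem_setOf_eq, openConn]
    constructor
    · rintro ⟨⟨h1, -⟩, h3⟩; exact ⟨h3, h1⟩
    · rintro ⟨h3, h1⟩; exact ⟨⟨h1, fun h2 => h1 (h2.trans h3.symm)⟩, h3⟩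
  rw [hI, hJ, hu1, hu2, hu3] at hGZ
  linarith [hGZ]

/-! ### The real inequality: near-`½` hairs, three failed exchanges, GZ and `Σ > 2` are contradictory -/

/-- The closing one-variable bound: the convex quadratic of the chain is `< 2` on `[493/790, 1]`. [this work] -/
theorem nearHalf_quadratic_bound (I : ℝ) (h1 : 493 / 790 < I) (h2 : I ≤ 1) :
    3 / 2 + 9207 / 8000 - 9207 / 8000 * (79 / 99 * I) - (9207 / 8000 - 1 / 2) * (I * (1 - I)) < 2 := by
  nlinarith [mul_nonneg (sub_nonneg.2 h1.le) (sub_nonneg.2 h2)]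

/-- Collecting the three marginals (`ThreePort.real_openConn`, `_b`, `_c`) by cells. [this work] -/
theorem sigma_cells_collect (α β γ Uab Uac Ubc U3 : ℝ) :
    (α + (1 - α) * (β * Uab + γ * Uac + (β + γ - β * γ) * U3)) +
      (β + (1 - β) * (α * Uab + γ * Ubc + (α + γ - α * γ) * U3)) +
      (γ + (1 - γ) * (α * Uac + β * Ubc + (α + β - α * β) * U3)) =
    (α + β + γ) + (α + β - 2 * α * β) * Uab + (α + γ - 2 * α * γ) * Uac + (β + γ - 2 * β * γ) * Ubc +
      ((1 - α) * (β + γ - β * γ) + (1 - β) * (α + γ - α * γ) + (1 - γ) * (α + β - α * β)) * U3 := by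
  ring

/-- **Pure real algebra.**  Hairs `α, β, γ ∈ [9/20, ½]`, nonnegative cells summing to `1`, the three failed exchanges in the form of
`ThreePort.margin_eq`, the Gladkov–Zimin row `(U0+Ubc)(Uab+Uac+U3) ≤ Uab+Uac+Ubc` and `Σ_v μ(o↔v) > 2` (marginals collected by
cells, `sigma_cells_collect`) cannot hold together.  Chain in the file header. [this work] -/
theorem nearHalf_residual_false (α β γ U0 Uab Uac Ubc U3 : ℝ)
    (hα0 : 9 / 20 ≤ α) (hα1 : α ≤ 1 / 2) (hβ0 : 9 / 20 ≤ β) (hβ1 : β ≤ 1 / 2) (hγ0 : 9 / 20 ≤ γ) (hγ1 : γ ≤ 1 / 2)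
    (h0 : 0 ≤ U0) (hab : 0 ≤ Uab) (hac : 0 ≤ Uac) (hbc : 0 ≤ Ubc) (h3 : 0 ≤ U3)
    (hsum : Uab + Uac + Ubc + U3 + U0 = 1)
    (ga : U0 * ((1 - α) * β * γ - α * (1 - β) * (1 - γ)) + Ubc * (β + γ - β * γ - α) < 0)
    (gb : U0 * ((1 - β) * α * γ - β * (1 - α) * (1 - γ)) + Uac * (α + γ - α * γ - β) < 0)
    (gc : U0 * ((1 - γ) * α * β - γ * (1 - α) * (1 - β)) + Uab * (α + β - α * β - γ) < 0)
    (hGZ : (U0 + Ubc) * (Uab + Uac + U3) ≤ Uab + Uac + Ubc)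
    (hSig : 2 < (α + β + γ) + (α + β - 2 * α * β) * Uab + (α + γ - 2 * α * γ) * Uac + (β + γ - 2 * β * γ) * Ubc +
      ((1 - α) * (β + γ - β * γ) + (1 - β) * (α + γ - α * γ) + (1 - γ) * (α + β - α * β)) * U3) : False := by
  -- the failed exchanges as caps `U_opp(v)·V_v < U0·T_v⁻`
  have ga' : Ubc * (β + γ - β * γ - α) < U0 * (α * (1 - β) * (1 - γ) - (1 - α) * β * γ) := by linarith only [ga]
  have gb' : Uac * (α + γ - α * γ - β) < U0 * (β * (1 - α) * (1 - γ) - (1 - β) * α * γ) := by linarith only [gb]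
  have gc' : Uab * (α + β - α * β - γ) < U0 * (γ * (1 - α) * (1 - β) - (1 - γ) * α * β) := by linarith only [gc]
  -- hair-box bounds: `V_v ≥ 79/400`
  have hbg : (1 - β) * (1 - γ) ≤ 11 / 20 * (11 / 20) := mul_le_mul (by linarith) (by linarith) (by linarith) (by norm_num)
  have hag : (1 - α) * (1 - γ) ≤ 11 / 20 * (11 / 20) := mul_le_mul (by linarith) (by linarith) (by linarith) (by norm_num)
  have habb : (1 - α) * (1 - β) ≤ 11 / 20 * (11 / 20) := mul_le_mul (by linarith) (by linarith) (by linarith) (by norm_num)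
  have eVa : β + γ - β * γ - α = 1 - (1 - β) * (1 - γ) - α := by ring
  have eVb : α + γ - α * γ - β = 1 - (1 - α) * (1 - γ) - β := by ring
  have eVc : α + β - α * β - γ = 1 - (1 - α) * (1 - β) - γ := by ring
  have hVa0 : 79 / 400 ≤ β + γ - β * γ - α := by linarith only [eVa, hbg, hα1]
  have hVb0 : 79 / 400 ≤ α + γ - α * γ - β := by linarith only [eVb, hag, hβ1]
  have hVc0 : 79 / 400 ≤ α + β - α * β - γ := by linarith only [eVc, habb, hγ1]
  -- `T_a⁻ ≤ 1/20`
  have hTa1 : α * (1 - β) * (1 - γ) - (1 - α) * β * γ ≤ 1 / 20 := by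
    have e : α * (1 - β) * (1 - γ) - (1 - α) * β * γ =
        1 / 2 * (1 - β - γ) - (1 / 2 - α) * ((1 - β) * (1 - γ) + β * γ) := by ring
    have hp : 0 ≤ (1 / 2 - α) * ((1 - β) * (1 - γ) + β * γ) :=
      mul_nonneg (by linarith) (add_nonneg (mul_nonneg (by linarith) (by linarith)) (mul_nonneg (by linarith) (by linarith)))
    linarith only [e, hp, hβ0, hγ0]
  -- `T_a⁻ + T_b⁻ + T_c⁻ ≤ 297/4000` (multilinear, decreasing in each hair on the box)
  have hTsum : (α * (1 - β) * (1 - γ) - (1 - α) * β * γ) + (β * (1 - α) * (1 - γ) - (1 - β) * α * γ) +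
      (γ * (1 - α) * (1 - β) - (1 - γ) * α * β) ≤ 297 / 4000 := by
    have e : (α * (1 - β) * (1 - γ) - (1 - α) * β * γ) + (β * (1 - α) * (1 - γ) - (1 - β) * α * γ) +
        (γ * (1 - α) * (1 - β) - (1 - γ) * α * β) = 297 / 4000 + (α - 9 / 20) * (1 - 3 * (β + γ - 2 * β * γ))
        + (β - 9 / 20) * (1 - 3 * (9 / 20 + γ - 2 * (9 / 20) * γ))
        + (γ - 9 / 20) * (1 - 3 * (9 / 20 + 9 / 20 - 2 * (9 / 20) * (9 / 20))) := by ring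
    have hprod : (1 - 2 * β) * (1 - 2 * γ) ≤ 1 / 10 * (1 / 10) :=
      mul_le_mul (by linarith) (by linarith) (by linarith) (by norm_num)
    have e2 : β + γ - 2 * β * γ = 1 / 2 - (1 - 2 * β) * (1 - 2 * γ) / 2 := by ring
    have h1 : (α - 9 / 20) * (1 - 3 * (β + γ - 2 * β * γ)) ≤ 0 :=
      mul_nonpos_of_nonneg_of_nonpos (by linarith) (by linarith only [e2, hprod])
    have h2 : (β - 9 / 20) * (1 - 3 * (9 / 20 + γ - 2 * (9 / 20) * γ)) ≤ 0 :=
      mul_nonpos_of_nonneg_of_nonpos (by linarith) (by linarith)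
    have h3' : (γ - 9 / 20) * (1 - 3 * (9 / 20 + 9 / 20 - 2 * (9 / 20) * (9 / 20))) ≤ 0 :=
      mul_nonpos_of_nonneg_of_nonpos (by linarith) (by norm_num)
    linarith only [e, h1, h2, h3']
  -- `c₃ ≤ 9207/8000` and `c_pair ≤ 1/2`
  have hc3 : (1 - α) * (β + γ - β * γ) + (1 - β) * (α + γ - α * γ) + (1 - γ) * (α + β - α * β) ≤ 9207 / 8000 := by
    have e : (1 - α) * (β + γ - β * γ) + (1 - β) * (α + γ - α * γ) + (1 - γ) * (α + β - α * β) =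
        9207 / 8000 + (α - 9 / 20) * (3 * ((1 - β) * (1 - γ)) - 1) + (β - 9 / 20) * (3 * ((1 - 9 / 20) * (1 - γ)) - 1)
        + (γ - 9 / 20) * (3 * ((1 - 9 / 20) * (1 - 9 / 20)) - 1) := by ring
    have h1 : (α - 9 / 20) * (3 * ((1 - β) * (1 - γ)) - 1) ≤ 0 :=
      mul_nonpos_of_nonneg_of_nonpos (by linarith) (by linarith only [hbg])
    have h2 : (β - 9 / 20) * (3 * ((1 - 9 / 20) * (1 - γ)) - 1) ≤ 0 :=
      mul_nonpos_of_nonneg_of_nonpos (by linarith) (by linarith)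
    have h3' : (γ - 9 / 20) * (3 * ((1 - 9 / 20) * (1 - 9 / 20)) - 1) ≤ 0 :=
      mul_nonpos_of_nonneg_of_nonpos (by linarith) (by norm_num)
    linarith only [e, h1, h2, h3']
  have hpab : α + β - 2 * α * β ≤ 1 / 2 := by
    have : 0 ≤ (1 - 2 * α) * (1 - 2 * β) := mul_nonneg (by linarith) (by linarith)
    linarith only [this]
  have hpac : α + γ - 2 * α * γ ≤ 1 / 2 := by
    have : 0 ≤ (1 - 2 * α) * (1 - 2 * γ) := mul_nonneg (by linarith) (by linarith)
    linarith only [this]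
  have hpbc : β + γ - 2 * β * γ ≤ 1 / 2 := by
    have : 0 ≤ (1 - 2 * β) * (1 - 2 * γ) := mul_nonneg (by linarith) (by linarith)
    linarith only [this]
  have hb1 : 79 / 400 * Ubc ≤ Ubc * (β + γ - β * γ - α) := by
    rw [mul_comm Ubc]; exact mul_le_mul_of_nonneg_right hVa0 hbc
  have hb2 : 79 / 400 * Uac ≤ Uac * (α + γ - α * γ - β) := by
    rw [mul_comm Uac]; exact mul_le_mul_of_nonneg_right hVb0 hac
  have hb3 : 79 / 400 * Uab ≤ Uab * (α + β - α * β - γ) := by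
    rw [mul_comm Uab]; exact mul_le_mul_of_nonneg_right hVc0 hab
  have hPcap : 79 / 400 * (Uab + Uac + Ubc) < 297 / 4000 * U0 := by
    have h4 := mul_le_mul_of_nonneg_left hTsum h0
    have e : U0 * ((α * (1 - β) * (1 - γ) - (1 - α) * β * γ) + (β * (1 - α) * (1 - γ) - (1 - β) * α * γ) +
        (γ * (1 - α) * (1 - β) - (1 - γ) * α * β)) = U0 * (α * (1 - β) * (1 - γ) - (1 - α) * β * γ) +
        U0 * (β * (1 - α) * (1 - γ) - (1 - β) * α * γ) + U0 * (γ * (1 - α) * (1 - β) - (1 - γ) * α * β) := by ring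
    linarith only [h4, e, hb1, hb2, hb3, ga', gb', gc']
  have hUbc : 79 / 400 * Ubc < 1 / 20 * U0 := by
    have h4 := mul_le_mul_of_nonneg_left hTa1 h0
    linarith only [h4, hb1, ga']
  have hU0pos : 0 < U0 := by
    by_contra h
    have h' : U0 ≤ 0 := not_lt.1 h
    linarith only [hUbc, hbc, h']
  -- Gladkov–Zimin with `I = U0 + Ubc`: `I (1 − I) ≤ P < (297/790) I`, so `I > 493/790`
  obtain ⟨I, hI⟩ : ∃ I : ℝ, I = U0 + Ubc := ⟨_, rfl⟩
  have hIpos : 0 < I := by rw [hI]; linarith only [hU0pos, hbc]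
  have hI1 : I ≤ 1 := by rw [hI]; linarith only [hsum, hab, hac, h3]
  have hGZ' : I * (1 - I) ≤ Uab + Uac + Ubc := by
    have hX : 1 - I = Uab + Uac + U3 := by rw [hI]; linarith only [hsum]
    rw [hX, hI]; exact hGZ
  have hPI : Uab + Uac + Ubc < 297 / 790 * I := by
    rw [hI]; linarith only [hPcap, hbc, h0]
  have hIlo : 493 / 790 < I := by
    have key : I * (1 - I) < 297 / 790 * I := lt_of_le_of_lt hGZ' hPI
    rw [not_le.symm]
    intro h
    have h2 : 0 ≤ 493 / 790 - I := sub_nonneg.2 h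
    have h3' : 0 ≤ I * (493 / 790 - I) := mul_nonneg hIpos.le h2
    have e : I * (493 / 790 - I) = I * (1 - I) - 297 / 790 * I := by ring
    rw [e] at h3'
    exact absurd key (not_lt.2 (sub_nonneg.1 h3'))
  have hU0I : 79 / 99 * I ≤ U0 := by rw [hI]; linarith only [hUbc]
  -- `Σ ≤ 3/2 + P/2 + c̄₃ U3`, `U3 = 1 − U0 − P`, `P ≥ I(1−I)`: a convex quadratic in `I`
  have t1 : (α + β - 2 * α * β) * Uab ≤ 1 / 2 * Uab := mul_le_mul_of_nonneg_right hpab hab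
  have t2 : (α + γ - 2 * α * γ) * Uac ≤ 1 / 2 * Uac := mul_le_mul_of_nonneg_right hpac hac
  have t3 : (β + γ - 2 * β * γ) * Ubc ≤ 1 / 2 * Ubc := mul_le_mul_of_nonneg_right hpbc hbc
  have t4 : ((1 - α) * (β + γ - β * γ) + (1 - β) * (α + γ - α * γ) + (1 - γ) * (α + β - α * β)) * U3 ≤
      9207 / 8000 * U3 := mul_le_mul_of_nonneg_right hc3 h3
  have hU3eq : U3 = 1 - U0 - (Uab + Uac + Ubc) := by linarith only [hsum]
  have hfin : 2 < 3 / 2 + 9207 / 8000 - 9207 / 8000 * (79 / 99 * I) - (9207 / 8000 - 1 / 2) * (I * (1 - I)) := by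
    linarith only [hSig, t1, t2, t3, t4, hα1, hβ1, hγ1, hU3eq, hU0I, hGZ']
  linarith only [hfin, nearHalf_quadratic_bound I hIlo hI1]

/-! ### The theorem at a three-port observer -/

/-- **`Z(3,2)` at a three-port observer with near-`½` hairs, for every graph off the observer.**  If `o` is adjacent (with positive
weight) only to `a, b, c`, the three hairs lie in `[9/20, ½]`, `Σ_v μ(o↔v) > 2` and `t ≥ μ(o↮v)` for `v = a, b, c`, then
`μ{o reaches at most one of a, b, c} ≤ t`.  Proof: an exchange at any apex suffices (`OneCutFive.measureReal_le_one_le_compl_of_exchange`);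
otherwise `margin_eq` (three apexes), `real_openConn` (three marginals), `cells_sum_eq_one`, `gz_offObserver` and
`nearHalf_residual_false`. [this work] -/
theorem le_one_reached_le_of_nearHalf_hairs (w : Sym2 (Fin n) → unitInterval) (R : Finset (Fin n)) (o a b c : Fin n) (t : ℝ)
    (hR : R = {a, b, c}) (hao : a ≠ o) (hbo : b ≠ o) (hco : c ≠ o) (hab : a ≠ b) (hac : a ≠ c) (hbc : b ≠ c)
    (hobs : ∀ u, u ≠ o → u ≠ a → u ≠ b → u ≠ c → w s(o, u) = 0)
    (hαlo : (9 / 20 : ℝ) ≤ w s(o, a)) (hαhi : (w s(o, a) : ℝ) ≤ 1 / 2)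
    (hβlo : (9 / 20 : ℝ) ≤ w s(o, b)) (hβhi : (w s(o, b) : ℝ) ≤ 1 / 2)
    (hγlo : (9 / 20 : ℝ) ≤ w s(o, c)) (hγhi : (w s(o, c) : ℝ) ≤ 1 / 2)
    (hsum : 2 < (prodBernoulli w).real (openConn o a) + (prodBernoulli w).real (openConn o b) +
      (prodBernoulli w).real (openConn o c))
    (hta : (prodBernoulli w).real (openConn o a)ᶜ ≤ t) (htb : (prodBernoulli w).real (openConn o b)ᶜ ≤ t)
    (htc : (prodBernoulli w).real (openConn o c)ᶜ ≤ t) :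
    (prodBernoulli w).real {ω : BondConfig (Fin n) | (R.filter fun v => ω ∈ openConn o v).card ≤ 1} ≤ t := by
  have ha : a ∈ R := (by simp [hR]); have hb : b ∈ R := (by simp [hR]); have hc : c ∈ R := by simp [hR]
  -- exchange at some apex suffices
  by_cases hA : (prodBernoulli w).real {ω | ω ∈ openConn o a ∧ ω ∉ openConn o b ∧ ω ∉ openConn o c} ≤
      (prodBernoulli w).real {ω | ω ∉ openConn o a ∧ ω ∈ openConn o b ∧ ω ∈ openConn o c}
  · exact (OneCutFive.measureReal_le_one_le_compl_of_exchange w R o a b c ha hb hc hab hac hbc hA).trans hta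
  by_cases hB : (prodBernoulli w).real {ω | ω ∈ openConn o b ∧ ω ∉ openConn o a ∧ ω ∉ openConn o c} ≤
      (prodBernoulli w).real {ω | ω ∉ openConn o b ∧ ω ∈ openConn o a ∧ ω ∈ openConn o c}
  · exact (OneCutFive.measureReal_le_one_le_compl_of_exchange w R o b a c hb ha hc hab.symm hbc hac hB).trans htb
  by_cases hC : (prodBernoulli w).real {ω | ω ∈ openConn o c ∧ ω ∉ openConn o a ∧ ω ∉ openConn o b} ≤
      (prodBernoulli w).real {ω | ω ∉ openConn o c ∧ ω ∈ openConn o a ∧ ω ∈ openConn o b}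
  · exact (OneCutFive.measureReal_le_one_le_compl_of_exchange w R o c a b hc ha hb hac.symm hbc.symm hab hC).trans htc
  exfalso
  push Not at hA hB hC
  have hobs' : ∀ u, u ≠ o → u ≠ b → u ≠ a → u ≠ c → w s(o, u) = 0 := fun u h1 h2 h3 h4 => hobs u h1 h3 h2 h4
  have hobs'' : ∀ u, u ≠ o → u ≠ c → u ≠ a → u ≠ b → w s(o, u) = 0 := fun u h1 h2 h3 h4 => hobs u h1 h3 h4 h2
  -- margins at the three apexes, marginals, cell bookkeeping, Gladkov–Zimin
  have hma := margin_eq w o a b c hao hbo hco hab hac hbc hobs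
  have hmb := margin_eq w o b a c hbo hao hco hab.symm hbc hac hobs'
  have hmc := margin_eq w o c a b hco hao hbo hac.symm hbc.symm hab hobs''
  have hqa := real_openConn w o a b c hao hbo hco hab hac hbc hobs
  have hqb := real_openConn_b w o a b c hao hbo hco hab hac hbc hobs
  have hqc := real_openConn_c w o a b c hao hbo hco hab hac hbc hobs
  have hcells := cells_sum_eq_one w o a b c
  have hGZ := gz_offObserver w o a b c
  -- the `b`- and `c`-apex cells in the `a`-dictionary (reachability is symmetric)
  have s1 : {ω : BondConfig (Fin n) | ¬ (openGraph (ω ∩ {e | o ∉ e})).Reachable b a ∧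
      ¬ (openGraph (ω ∩ {e | o ∉ e})).Reachable b c ∧ ¬ (openGraph (ω ∩ {e | o ∉ e})).Reachable a c} =
      {ω | ¬ (openGraph (ω ∩ {e | o ∉ e})).Reachable a b ∧
        ¬ (openGraph (ω ∩ {e | o ∉ e})).Reachable a c ∧ ¬ (openGraph (ω ∩ {e | o ∉ e})).Reachable b c} := by
    ext ω; simp only [Set.mem_setOf_eq]
    exact ⟨fun ⟨h1, h2, h3⟩ => ⟨fun h => h1 h.symm, h3, h2⟩, fun ⟨h1, h2, h3⟩ => ⟨fun h => h1 h.symm, h3, h2⟩⟩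
  have s2 : {ω : BondConfig (Fin n) | (openGraph (ω ∩ {e | o ∉ e})).Reachable a c ∧
      ¬ (openGraph (ω ∩ {e | o ∉ e})).Reachable b a} =
      {ω | (openGraph (ω ∩ {e | o ∉ e})).Reachable a c ∧ ¬ (openGraph (ω ∩ {e | o ∉ e})).Reachable a b} := by
    ext ω; simp only [Set.mem_setOf_eq]
    exact ⟨fun ⟨h1, h2⟩ => ⟨h1, fun h => h2 h.symm⟩, fun ⟨h1, h2⟩ => ⟨h1, fun h => h2 h.symm⟩⟩
  have s3 : {ω : BondConfig (Fin n) | ¬ (openGraph (ω ∩ {e | o ∉ e})).Reachable c a ∧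
      ¬ (openGraph (ω ∩ {e | o ∉ e})).Reachable c b ∧ ¬ (openGraph (ω ∩ {e | o ∉ e})).Reachable a b} =
      {ω | ¬ (openGraph (ω ∩ {e | o ∉ e})).Reachable a b ∧
        ¬ (openGraph (ω ∩ {e | o ∉ e})).Reachable a c ∧ ¬ (openGraph (ω ∩ {e | o ∉ e})).Reachable b c} := by
    ext ω; simp only [Set.mem_setOf_eq]
    exact ⟨fun ⟨h1, h2, h3⟩ => ⟨h3, fun h => h1 h.symm, fun h => h2 h.symm⟩,
      fun ⟨h1, h2, h3⟩ => ⟨fun h => h2 h.symm, fun h => h3 h.symm, h1⟩⟩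
  have s4 : {ω : BondConfig (Fin n) | (openGraph (ω ∩ {e | o ∉ e})).Reachable a b ∧
      ¬ (openGraph (ω ∩ {e | o ∉ e})).Reachable c a} =
      {ω | (openGraph (ω ∩ {e | o ∉ e})).Reachable a b ∧ ¬ (openGraph (ω ∩ {e | o ∉ e})).Reachable a c} := by
    ext ω; simp only [Set.mem_setOf_eq]
    exact ⟨fun ⟨h1, h2⟩ => ⟨h1, fun h => h2 h.symm⟩, fun ⟨h1, h2⟩ => ⟨h1, fun h => h2 h.symm⟩⟩
  rw [s1, s2] at hmb
  rw [s3, s4] at hmc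
  -- abbreviations
  set μ := prodBernoulli w with hμ
  set U0 : ℝ := μ.real {ω : BondConfig (Fin n) | ¬ (openGraph (ω ∩ {e | o ∉ e})).Reachable a b ∧
      ¬ (openGraph (ω ∩ {e | o ∉ e})).Reachable a c ∧ ¬ (openGraph (ω ∩ {e | o ∉ e})).Reachable b c} with hU0
  set Uab : ℝ := μ.real {ω : BondConfig (Fin n) | (openGraph (ω ∩ {e | o ∉ e})).Reachable a b ∧
      ¬ (openGraph (ω ∩ {e | o ∉ e})).Reachable a c} with hUab
  set Uac : ℝ := μ.real {ω : BondConfig (Fin n) | (openGraph (ω ∩ {e | o ∉ e})).Reachable a c ∧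
      ¬ (openGraph (ω ∩ {e | o ∉ e})).Reachable a b} with hUac
  set Ubc : ℝ := μ.real {ω : BondConfig (Fin n) | (openGraph (ω ∩ {e | o ∉ e})).Reachable b c ∧
      ¬ (openGraph (ω ∩ {e | o ∉ e})).Reachable a b} with hUbc
  set U3 : ℝ := μ.real {ω : BondConfig (Fin n) | (openGraph (ω ∩ {e | o ∉ e})).Reachable a b ∧
      (openGraph (ω ∩ {e | o ∉ e})).Reachable a c} with hU3
  set α : ℝ := (w s(o, a) : ℝ) with hα
  set β : ℝ := (w s(o, b) : ℝ) with hβ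
  set γ : ℝ := (w s(o, c) : ℝ) with hγ
  have h0 : 0 ≤ U0 := measureReal_nonneg
  have habn : 0 ≤ Uab := measureReal_nonneg
  have hacn : 0 ≤ Uac := measureReal_nonneg
  have hbcn : 0 ≤ Ubc := measureReal_nonneg
  have h3n : 0 ≤ U3 := measureReal_nonneg
  -- the three failed exchanges in cell form
  have ga : U0 * ((1 - α) * β * γ - α * (1 - β) * (1 - γ)) + Ubc * (β + γ - β * γ - α) < 0 := by linarith [hma, hA]
  have gb : U0 * ((1 - β) * α * γ - β * (1 - α) * (1 - γ)) + Uac * (α + γ - α * γ - β) < 0 := by linarith [hmb, hB]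
  have gc : U0 * ((1 - γ) * α * β - γ * (1 - α) * (1 - β)) + Uab * (α + β - α * β - γ) < 0 := by linarith [hmc, hC]
  have hSig : 2 < (α + β + γ) + (α + β - 2 * α * β) * Uab + (α + γ - 2 * α * γ) * Uac + (β + γ - 2 * β * γ) * Ubc +
      ((1 - α) * (β + γ - β * γ) + (1 - β) * (α + γ - α * γ) + (1 - γ) * (α + β - α * β)) * U3 := by
    rw [hqa, hqb, hqc, sigma_cells_collect] at hsum; exact hsum
  exact nearHalf_residual_false α β γ U0 Uab Uac Ubc U3 hαlo hαhi hβlo hβhi hγlo hγhi h0 habn hacn hbcn h3n hcells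
    ga gb gc hGZ hSig

/-- **All three hairs `≥ 9/20` suffice** (no upper bound): if some hair exceeds `½` the heavy-hair theorem
`pocketExchange_of_half_le_hair` gives the exchange at the weakest relay; otherwise `le_one_reached_le_of_nearHalf_hairs`. [this work] -/
theorem le_one_reached_le_of_hairs_ge (w : Sym2 (Fin n) → unitInterval) (R : Finset (Fin n)) (o a b c : Fin n) (t : ℝ)
    (hR : R = {a, b, c}) (hao : a ≠ o) (hbo : b ≠ o) (hco : c ≠ o) (hab : a ≠ b) (hac : a ≠ c) (hbc : b ≠ c)
    (hobs : ∀ u, u ≠ o → u ≠ a → u ≠ b → u ≠ c → w s(o, u) = 0)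
    (hαlo : (9 / 20 : ℝ) ≤ w s(o, a)) (hβlo : (9 / 20 : ℝ) ≤ w s(o, b)) (hγlo : (9 / 20 : ℝ) ≤ w s(o, c))
    (hsum : 2 < (prodBernoulli w).real (openConn o a) + (prodBernoulli w).real (openConn o b) +
      (prodBernoulli w).real (openConn o c))
    (hta : (prodBernoulli w).real (openConn o a)ᶜ ≤ t) (htb : (prodBernoulli w).real (openConn o b)ᶜ ≤ t)
    (htc : (prodBernoulli w).real (openConn o c)ᶜ ≤ t) :
    (prodBernoulli w).real {ω : BondConfig (Fin n) | (R.filter fun v => ω ∈ openConn o v).card ≤ 1} ≤ t := by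
  by_cases hhi : (w s(o, a) : ℝ) ≤ 1 / 2 ∧ (w s(o, b) : ℝ) ≤ 1 / 2 ∧ (w s(o, c) : ℝ) ≤ 1 / 2
  · exact le_one_reached_le_of_nearHalf_hairs w R o a b c t hR hao hbo hco hab hac hbc hobs hαlo hhi.1 hβlo hhi.2.1
      hγlo hhi.2.2 hsum hta htb htc
  have hhalf : (1 / 2 : ℝ) ≤ w s(o, a) ∨ (1 / 2 : ℝ) ≤ w s(o, b) ∨ (1 / 2 : ℝ) ≤ w s(o, c) := by
    by_contra h
    push Not at h
    exact hhi ⟨h.1.le, h.2.1.le, h.2.2.le⟩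
  have ha : a ∈ R := (by simp [hR]); have hb : b ∈ R := (by simp [hR]); have hc : c ∈ R := by simp [hR]
  have hobs' : ∀ u, u ≠ o → u ≠ b → u ≠ a → u ≠ c → w s(o, u) = 0 := fun u h1 h2 h3 h4 => hobs u h1 h3 h2 h4
  have hobs'' : ∀ u, u ≠ o → u ≠ c → u ≠ a → u ≠ b → w s(o, u) = 0 := fun u h1 h2 h3 h4 => hobs u h1 h3 h4 h2
  set μ := prodBernoulli w with hμ
  rcases le_total (μ.real (openConn o a)) (μ.real (openConn o b)) with hqab | hqba
  · rcases le_total (μ.real (openConn o a)) (μ.real (openConn o c)) with hqac | hqca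
    · exact (OneCutFive.measureReal_le_one_le_compl_of_exchange w R o a b c ha hb hc hab hac hbc
        (pocketExchange_of_half_le_hair w o a b c hao hbo hco hab hac hbc hobs hhalf hqab hqac)).trans hta
    · have hhalf' : (1 / 2 : ℝ) ≤ w s(o, c) ∨ (1 / 2 : ℝ) ≤ w s(o, a) ∨ (1 / 2 : ℝ) ≤ w s(o, b) := by tauto
      exact (OneCutFive.measureReal_le_one_le_compl_of_exchange w R o c a b hc ha hb hac.symm hbc.symm hab
        (pocketExchange_of_half_le_hair w o c a b hco hao hbo hac.symm hbc.symm hab hobs'' hhalf' hqca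
          (hqca.trans hqab))).trans htc
  · rcases le_total (μ.real (openConn o b)) (μ.real (openConn o c)) with hqbc | hqcb
    · have hhalf' : (1 / 2 : ℝ) ≤ w s(o, b) ∨ (1 / 2 : ℝ) ≤ w s(o, a) ∨ (1 / 2 : ℝ) ≤ w s(o, c) := by tauto
      exact (OneCutFive.measureReal_le_one_le_compl_of_exchange w R o b a c hb ha hc hab.symm hbc hac
        (pocketExchange_of_half_le_hair w o b a c hbo hao hco hab.symm hbc hac hobs' hhalf' hqba hqbc)).trans htb
    · have hhalf' : (1 / 2 : ℝ) ≤ w s(o, c) ∨ (1 / 2 : ℝ) ≤ w s(o, a) ∨ (1 / 2 : ℝ) ≤ w s(o, b) := by tauto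
      exact (OneCutFive.measureReal_le_one_le_compl_of_exchange w R o c a b hc ha hb hac.symm hbc.symm hab
        (pocketExchange_of_half_le_hair w o c a b hco hao hbo hac.symm hbc.symm hab hobs'' hhalf' (hqcb.trans hqba)
          hqcb)).trans htc

end ThreePort

end Summit.CriticalPhenomena.PercolationContinuityZ3.Theorems

end
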